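import Summits.QuantumFields.YangMills.Theorems.VirialFluxGapSharpTwistedLaplaceQuantitativeLaplacePointwise
import HarnessLib

/-!
# Laplace's method with an EXPLICIT, DIMENSION-POLYNOMIAL remainder `O(1/β)`
# (interior non-degenerate minimum, parity-improved second order)

Helper module (free-hands work of width seat ym-line-sfw-p2-w2 g49, cell ym-idea-1) toward crux
⟨stmt-QuantumFields-24204⟩ `VirialFluxGap.SharpTwistedLaplace` (r301 of route VirialFluxGap; the leaf served by
LINE g15-A route TwistEaterVolume ∕ ⟨24319⟩ TubeVolumeLaw) by the DIRECT Laplace method at the twist-eater orbits: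
the leaf's window `L ≤ β^a` allows `β ≥ poly(L)`, so `log ∫e^{−βF_z}dμ = −9L⁴·log β + C(L,z) ± K·L^q/β` needs a
Laplace remainder with constants POLYNOMIAL IN THE DIMENSION `m = 18L⁴` and of order `1/β` (not `β^{−1/2}`).
The tree's Laplace files (`Literature/Analysis/Asymptotics/LaplaceMethodMultivariate`, `…MorseBottFibred`,
`…Chart`, `…Orbit*`, `…CompactGroup*`) are LIMIT statements at fixed dimension; this module is the quantitative
Euclidean core (the orbit ∕ slice and chart layers with `poly(L)` constants are the remaining steps, to be
consumed with it exactly as with the limit form).  Everything here is PROVED; no definitions, no named facts;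
pure real analysis (namespace `Summit.QuantumFields.YangMills.Theorems.QuantitativeLaplace`).
THIS FILE = PART 3/3 (§3b the Gaussian tail, the remainder integral, ★★ `laplaceMethod_quantitative` and its consumer form); parts 1/3, 2/3 = `…QuantitativeLaplaceGauss`, `…QuantitativeLaplacePointwise`.

THE STATEMENT (★★ `laplaceMethod_quantitative`, consumer form `laplaceMethod_quantitative_of_eqOn`).
`V` a real inner product space of dimension `m`, Lebesgue measure; `A` symmetric with `λ‖y‖² ≤ ⟪Ay, y⟫`
(`λ > 0`); on the closed ball `‖y‖ ≤ R` a phase `f = ½⟪Ay,y⟫ + c + r` and a weight `w = w₀(1 + ℓ + e)` with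
`c`, `ℓ` ODD (`c(−y) = −c(y)`, `ℓ(−y) = −ℓ(y)`; e.g. the cubic Taylor form of the phase and the linear Taylor
form of the weight), `|c| ≤ A₃‖y‖³`, `|r| ≤ A₄‖y‖⁴`, `|ℓ| ≤ D‖y‖`, `|e| ≤ G‖y‖²` on the ball
(`A₃, A₄, D, G ≥ 0`, `c, r, ℓ, e` measurable), and the smallness of the window
`A₃R + A₄R² ≤ λ/(8(m+8))`, `DR ≤ 1`, `GR² ≤ 1`.  THEN for every `β > 0`

  `|∫_{‖y‖≤R} e^{−βf} w dy − w₀𝔊(β)| ≤ (K/β)·w₀𝔊(β)`,  `𝔊(β) = (2π/β)^{m/2}/√det A`,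

with the EXPLICIT constant
`K = 16(m+8)/(λR²) + 16G(m+8)/λ + 256(A₄ + (A₃+A₄R)(D+GR))(m+8)²/λ² + 18432(A₃+A₄R)²(m+8)³/λ³`
— polynomial in the dimension and in the data; no hypothesis couples `β` to the data (the tail off the
ball is paid by the linear Markov bound `1 ≤ 2q/(λR²)`, at the price `16(m+8)/(λR²β)`).  The first-order
terms `−βc + ℓ` are odd and integrate to zero against the even Gaussian on the symmetric ball, which is
why the remainder is `O(1/β)` and not `O(β^{−1/2})` (the integer-power structure of the Laplace expansion
at an interior non-degenerate critical point); the second-order terms are bounded by Gaussian moments,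
estimated by the pointwise bound `qᵏe^{−εβq} ≤ k!/(εβ)ᵏ` (`ε = 1/(4(m+8))`) at the price of the factor
`(1 − 1/(2(m+8)))^{−m/2} ≤ 2`, so that no constant exponential in `m` appears.  Structure of the proof:
§1 elementary inequalities; §2 the scaled anisotropic Gaussian `∫e^{−s·½⟪Ay,y⟫} = (2π/s)^{m/2}/√det A`,
the moment bound `integral_pow_mul_exp_neg_le`, the odd-integrand lemma; §3 the pointwise second-order
bound on the ball (`laplace_pointwise_remainder_le`), the tail (`laplace_tail_le`), the remainder integral
(`laplace_remainder_integral_le`), assembly.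

WHY (the use).  «`β → ∞` at a box that GROWS with `β`» statements (e.g. Laplace windows `L ≤ β^a` of
lattice partition functions, where the number of integration variables is polynomial in `L`) need the
Laplace remainder with constants explicit in the dimension; the tree's limit theorems
(`tendsto_laplaceMethod`, `…_fibred`, `…_orbit`) fix the dimension.  This file is the Euclidean core; the
orbit ∕ chart layers are consumed with it exactly as with the limit form.

HONEST FRAMING: classical real analysis; width 0 by itself toward any lattice statement; ⟨24204⟩, ⟨24319⟩ and
every rung stay OPEN; the Yang–Mills mass gap (Clay) is NOT touched; no summit is proved by a line.

## References
* K. W. Breitung, *Asymptotic Approximations for Probability Integrals*, LNM 1592 (1994), Lemma 26 p. 30,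
  Thm 41 p. 56 (leading order; the proof (5.29)–(5.36) made quantitative here). [Breitung1994]
* R. Wong, *Asymptotic Approximations of Integrals*, SIAM Classics 34 (2001), §IX.5 (expansion in INTEGER
  powers of `1/λ` at an interior non-degenerate critical point: odd terms vanish). [Wong2001AsymptoticApproximationsIntegrals]
-/

noncomputable section

open _root_.MeasureTheory _root_.Filter _root_.Set _root_.Module _root_.Metric
open scoped _root_.Topology _root_.Real _root_.InnerProductSpace

namespace Summit.QuantumFields.YangMills.Theorems.QuantitativeLaplace

open Literature.Analysis.Asymptotics
open Literature.Analysis.UnboundedOperators (abs_exp_sub_one_sub_le_sq_mul_exp_abs)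

/-! ## §3b The tail, the remainder integral, the theorem -/

section MainB

variable {V : Type*} [NormedAddCommGroup V] [InnerProductSpace ℝ V] [FiniteDimensional ℝ V]
  [MeasurableSpace V] [BorelSpace V]
variable {A : V →ₗ[ℝ] V} {lam : ℝ}


/-- **The Gaussian tail off the ball**: `∫_{‖y‖>R} e^{−βq} ≤ (16(m+8)/(λR²β))·𝔊(β)` (linear Markov
`1 ≤ 2q/(λR²)` off the ball and the first moment bound). [cite: Breitung1994, Lemma 39 p. 55] -/
theorem laplace_tail_le (hA : A.IsSymmetric) (hlam : 0 < lam)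
    (hcoer : ∀ y : V, lam * ‖y‖ ^ 2 ≤ ⟪A y, y⟫_ℝ) {R β : ℝ} (hR : 0 < R) (hβ : 0 < β) :
    ∫ y in (closedBall (0 : V) R)ᶜ, Real.exp (-(β * ((1 / 2) * ⟪A y, y⟫_ℝ))) ≤
      16 * ((finrank ℝ V : ℝ) + 8) / (lam * R ^ 2) / β * ((2 * π / β) ^ ((finrank ℝ V : ℝ) / 2) / Real.sqrt (LinearMap.det A)) := by
  have hq0 : ∀ y : V, 0 ≤ ((1 / 2) * ⟪A y, y⟫_ℝ) := fun y => half_inner_nonneg_of_coercive hlam hcoer y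
  have hqn : ∀ y : V, ‖y‖ ^ 2 ≤ (2 / lam) * ((1 / 2) * ⟪A y, y⟫_ℝ) := fun y => norm_sq_le_of_coercive hlam hcoer y
  have hm0 : (0 : ℝ) ≤ (finrank ℝ V : ℝ) := Nat.cast_nonneg _
  have hg₀int : Integrable (fun y : V => Real.exp (-(β * ((1 / 2) * ⟪A y, y⟫_ℝ)))) := integrable_exp_neg_mul_half_inner hlam hcoer hβ
  have hmom1 := integral_pow_mul_exp_neg_le hA hlam hcoer 1 hβ (t := 1)
    (by have : 0 < 1 / (4 * ((finrank ℝ V : ℝ) + 8)) := by positivity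
        linarith)
  have hmint := integrable_pow_mul_exp_neg_mul_half_inner hlam hcoer 1 (show 0 < 1 * β by linarith)
  have h1 : ∫ y in (closedBall (0 : V) R)ᶜ, Real.exp (-(β * ((1 / 2) * ⟪A y, y⟫_ℝ))) ≤
      ∫ y in (closedBall (0 : V) R)ᶜ, (2 / (lam * R ^ 2)) * (((1 / 2) * ⟪A y, y⟫_ℝ) ^ 1 * Real.exp (-(1 * β * ((1 / 2) * ⟪A y, y⟫_ℝ)))) := by
    apply setIntegral_mono_on hg₀int.integrableOn (hmint.const_mul _).integrableOn
      measurableSet_closedBall.compl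
    intro y hy
    have hyR : R < ‖y‖ := by simpa using hy
    have hR2 : R ^ 2 ≤ ‖y‖ ^ 2 := pow_le_pow_left₀ hR.le hyR.le 2
    have hfac : 1 ≤ 2 / (lam * R ^ 2) * ((1 / 2) * ⟪A y, y⟫_ℝ) := by
      have h := hqn y
      rw [div_mul_eq_mul_div, le_div_iff₀ hlam] at h
      rw [div_mul_eq_mul_div, le_div_iff₀ (by positivity)]
      nlinarith
    rw [pow_one, one_mul]
    calc Real.exp (-(β * ((1 / 2) * ⟪A y, y⟫_ℝ))) = 1 * Real.exp (-(β * ((1 / 2) * ⟪A y, y⟫_ℝ))) := (one_mul _).symm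
      _ ≤ (2 / (lam * R ^ 2) * ((1 / 2) * ⟪A y, y⟫_ℝ)) * Real.exp (-(β * ((1 / 2) * ⟪A y, y⟫_ℝ))) := mul_le_mul_of_nonneg_right hfac (Real.exp_pos _).le
      _ = _ := by ring
  have h2 : ∫ y in (closedBall (0 : V) R)ᶜ, (2 / (lam * R ^ 2)) * (((1 / 2) * ⟪A y, y⟫_ℝ) ^ 1 * Real.exp (-(1 * β * ((1 / 2) * ⟪A y, y⟫_ℝ)))) ≤
      ∫ y, (2 / (lam * R ^ 2)) * (((1 / 2) * ⟪A y, y⟫_ℝ) ^ 1 * Real.exp (-(1 * β * ((1 / 2) * ⟪A y, y⟫_ℝ)))) :=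
    setIntegral_le_integral (hmint.const_mul _) (Eventually.of_forall fun y => by have := hq0 y; positivity)
  have h3 : ∫ y, (2 / (lam * R ^ 2)) * (((1 / 2) * ⟪A y, y⟫_ℝ) ^ 1 * Real.exp (-(1 * β * ((1 / 2) * ⟪A y, y⟫_ℝ)))) =
      (2 / (lam * R ^ 2)) * ∫ y, ((1 / 2) * ⟪A y, y⟫_ℝ) ^ 1 * Real.exp (-(1 * β * ((1 / 2) * ⟪A y, y⟫_ℝ))) := integral_const_mul _ _
  calc ∫ y in (closedBall (0 : V) R)ᶜ, Real.exp (-(β * ((1 / 2) * ⟪A y, y⟫_ℝ)))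
      ≤ (2 / (lam * R ^ 2)) * ∫ y, ((1 / 2) * ⟪A y, y⟫_ℝ) ^ 1 * Real.exp (-(1 * β * ((1 / 2) * ⟪A y, y⟫_ℝ))) := (h1.trans h2).trans_eq h3
    _ ≤ (2 / (lam * R ^ 2)) * (2 * (Nat.factorial 1) * (4 * ((finrank ℝ V : ℝ) + 8) / β) ^ 1 * ((2 * π / β) ^ ((finrank ℝ V : ℝ) / 2) / Real.sqrt (LinearMap.det A))) := by
        gcongr
    _ = 16 * ((finrank ℝ V : ℝ) + 8) / (lam * R ^ 2) / β * ((2 * π / β) ^ ((finrank ℝ V : ℝ) / 2) / Real.sqrt (LinearMap.det A)) := by simp [Nat.factorial]; ring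

/-- **The second-order remainder integrates to `O(1/β)·𝔊(β)`** with an explicit polynomial constant.
[cite: Breitung1994, Thm 41 proof (5.33)–(5.36) p. 57] -/
theorem laplace_remainder_integral_le (hA : A.IsSymmetric) (hlam : 0 < lam)
    (hcoer : ∀ y : V, lam * ‖y‖ ^ 2 ≤ ⟪A y, y⟫_ℝ)
    {R A₃ A₄ D G β : ℝ} (hR : 0 < R) (hA₃ : 0 ≤ A₃) (hA₄ : 0 ≤ A₄) (hD : 0 ≤ D) (hG : 0 ≤ G)
    (hβ : 0 < β)
    (hsmall : A₃ * R + A₄ * R ^ 2 ≤ lam / (8 * ((finrank ℝ V : ℝ) + 8)))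
    (hDR : D * R ≤ 1) (hGR : G * R ^ 2 ≤ 1)
    {c r ℓ e : V → ℝ} (hc_meas : Measurable c) (hr_meas : Measurable r) (hℓ_meas : Measurable ℓ)
    (he_meas : Measurable e)
    (hc : ∀ y : V, ‖y‖ ≤ R → |c y| ≤ A₃ * ‖y‖ ^ 3) (hr : ∀ y : V, ‖y‖ ≤ R → |r y| ≤ A₄ * ‖y‖ ^ 4)
    (hℓ : ∀ y : V, ‖y‖ ≤ R → |ℓ y| ≤ D * ‖y‖) (he : ∀ y : V, ‖y‖ ≤ R → |e y| ≤ G * ‖y‖ ^ 2) :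
    |∫ y in closedBall (0 : V) R, ((Real.exp (-(β * (((1 / 2) * ⟪A y, y⟫_ℝ) + c y + r y))) * (1 + ℓ y + e y)) - Real.exp (-(β * ((1 / 2) * ⟪A y, y⟫_ℝ))) - (Real.exp (-(β * ((1 / 2) * ⟪A y, y⟫_ℝ))) * (-(β * c y) + ℓ y)))| ≤
      (16 * G * ((finrank ℝ V : ℝ) + 8) / lam + 256 * (A₄ + (A₃ + A₄ * R) * (D + G * R)) * ((finrank ℝ V : ℝ) + 8) ^ 2 / lam ^ 2
        + 18432 * (A₃ + A₄ * R) ^ 2 * ((finrank ℝ V : ℝ) + 8) ^ 3 / lam ^ 3) / β * ((2 * π / β) ^ ((finrank ℝ V : ℝ) / 2) / Real.sqrt (LinearMap.det A)) := by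
  set M : ℝ := ((finrank ℝ V : ℝ) + 8) with hM
  set 𝔊 : ℝ := ((2 * π / β) ^ ((finrank ℝ V : ℝ) / 2) / Real.sqrt (LinearMap.det A)) with h𝔊
  set B : Set V := closedBall (0 : V) R with hB
  set τ : ℝ := 2 * (A₃ * R + A₄ * R ^ 2) / lam with hτ
  have hm0 : (0 : ℝ) ≤ (finrank ℝ V : ℝ) := Nat.cast_nonneg _
  have hMpos : 0 < M := by rw [hM]; positivity
  have hq0 : ∀ y : V, 0 ≤ ((1 / 2) * ⟪A y, y⟫_ℝ) := fun y => half_inner_nonneg_of_coercive hlam hcoer y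
  have hτle : τ ≤ 1 / (4 * M) := by rw [hτ, hM]; exact laplace_tau_le (V := V) hlam hsmall
  have h1τ : 0 < (1 - τ) * β := by
    have : τ ≤ 1 / 32 := hτle.trans (by
      rw [div_le_div_iff₀ (by positivity) (by norm_num)]; rw [hM]; linarith)
    have : 0 < 1 - τ := by linarith
    positivity
  -- measurability and integrability on the ball
  have hq_meas : Measurable fun y : V => ((1 / 2) * ⟪A y, y⟫_ℝ) := (continuous_half_inner A).measurable
  have hg_meas : Measurable fun y : V => (Real.exp (-(β * (((1 / 2) * ⟪A y, y⟫_ℝ) + c y + r y))) * (1 + ℓ y + e y)) :=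
    ((((hq_meas.add hc_meas).add hr_meas).const_mul β).neg.exp).mul
      ((measurable_const.add hℓ_meas).add he_meas)
  have hg₀_meas : Measurable fun y : V => Real.exp (-(β * ((1 / 2) * ⟪A y, y⟫_ℝ))) := (hq_meas.const_mul β).neg.exp
  have hod_meas : Measurable fun y : V => (Real.exp (-(β * ((1 / 2) * ⟪A y, y⟫_ℝ))) * (-(β * c y) + ℓ y)) := hg₀_meas.mul ((hc_meas.const_mul β).neg.add hℓ_meas)
  have hBfin : volume B ≠ ⊤ := by rw [hB]; exact measure_closedBall_lt_top.ne
  have hBm : MeasurableSet B := by rw [hB]; exact measurableSet_closedBall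
  have hgB : IntegrableOn (fun y : V => (Real.exp (-(β * (((1 / 2) * ⟪A y, y⟫_ℝ) + c y + r y))) * (1 + ℓ y + e y))) B :=
    Measure.integrableOn_of_bounded hBfin hg_meas.aestronglyMeasurable
      ((ae_restrict_iff' hBm).mpr (Eventually.of_forall fun y hy => by
        rw [Real.norm_eq_abs]
        exact laplace_abs_integrand_le_three hlam hcoer hA₃ hA₄ hD hG hβ hsmall hDR hGR hc hr hℓ he y
          (by simpa [hB] using hy)))
  have hodB : IntegrableOn (fun y : V => (Real.exp (-(β * ((1 / 2) * ⟪A y, y⟫_ℝ))) * (-(β * c y) + ℓ y))) B :=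
    Measure.integrableOn_of_bounded hBfin hod_meas.aestronglyMeasurable
      ((ae_restrict_iff' hBm).mpr (Eventually.of_forall fun y hy => by
        rw [Real.norm_eq_abs]
        exact laplace_abs_odd_le hlam hcoer hA₃ hD hβ hc hℓ y (by simpa [hB] using hy)))
  have hg₀B : IntegrableOn (fun y : V => Real.exp (-(β * ((1 / 2) * ⟪A y, y⟫_ℝ)))) B :=
    (integrable_exp_neg_mul_half_inner hlam hcoer hβ).integrableOn
  have hb₁int : Integrable fun y : V => G * (2 / lam) * (((1 / 2) * ⟪A y, y⟫_ℝ) ^ 1 * Real.exp (-(1 * β * ((1 / 2) * ⟪A y, y⟫_ℝ)))) :=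
    (integrable_pow_mul_exp_neg_mul_half_inner hlam hcoer 1 (show 0 < 1 * β by linarith)).const_mul _
  have hb₂int : Integrable fun y : V => β * (A₄ + (A₃ + A₄ * R) * (D + G * R)) * (2 / lam) ^ 2 * (((1 / 2) * ⟪A y, y⟫_ℝ) ^ 2 * Real.exp (-(1 * β * ((1 / 2) * ⟪A y, y⟫_ℝ)))) :=
    (integrable_pow_mul_exp_neg_mul_half_inner hlam hcoer 2 (show 0 < 1 * β by linarith)).const_mul _
  have hb₃int : Integrable fun y : V => 3 * β ^ 2 * (A₃ + A₄ * R) ^ 2 * (2 / lam) ^ 3 * (((1 / 2) * ⟪A y, y⟫_ℝ) ^ 3 * Real.exp (-((1 - 2 * (A₃ * R + A₄ * R ^ 2) / lam) * β * ((1 / 2) * ⟪A y, y⟫_ℝ)))) := by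
    refine (integrable_pow_mul_exp_neg_mul_half_inner hlam hcoer 3 h1τ).const_mul _
  have hbint : Integrable fun y : V => G * (2 / lam) * (((1 / 2) * ⟪A y, y⟫_ℝ) ^ 1 * Real.exp (-(1 * β * ((1 / 2) * ⟪A y, y⟫_ℝ)))) + β * (A₄ + (A₃ + A₄ * R) * (D + G * R)) * (2 / lam) ^ 2 * (((1 / 2) * ⟪A y, y⟫_ℝ) ^ 2 * Real.exp (-(1 * β * ((1 / 2) * ⟪A y, y⟫_ℝ)))) + 3 * β ^ 2 * (A₃ + A₄ * R) ^ 2 * (2 / lam) ^ 3 * (((1 / 2) * ⟪A y, y⟫_ℝ) ^ 3 * Real.exp (-((1 - 2 * (A₃ * R + A₄ * R ^ 2) / lam) * β * ((1 / 2) * ⟪A y, y⟫_ℝ)))) := (hb₁int.add hb₂int).add hb₃int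
  have hb0 : ∀ y : V, 0 ≤ G * (2 / lam) * (((1 / 2) * ⟪A y, y⟫_ℝ) ^ 1 * Real.exp (-(1 * β * ((1 / 2) * ⟪A y, y⟫_ℝ)))) + β * (A₄ + (A₃ + A₄ * R) * (D + G * R)) * (2 / lam) ^ 2 * (((1 / 2) * ⟪A y, y⟫_ℝ) ^ 2 * Real.exp (-(1 * β * ((1 / 2) * ⟪A y, y⟫_ℝ)))) + 3 * β ^ 2 * (A₃ + A₄ * R) ^ 2 * (2 / lam) ^ 3 * (((1 / 2) * ⟪A y, y⟫_ℝ) ^ 3 * Real.exp (-((1 - 2 * (A₃ * R + A₄ * R ^ 2) / lam) * β * ((1 / 2) * ⟪A y, y⟫_ℝ)))) := fun y => by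
    have := hq0 y; positivity
  -- the moment bounds
  have hmom1 := integral_pow_mul_exp_neg_le hA hlam hcoer 1 hβ (t := 1)
    (by have : 0 < 1 / (4 * ((finrank ℝ V : ℝ) + 8)) := by positivity
        linarith)
  have hmom2 := integral_pow_mul_exp_neg_le hA hlam hcoer 2 hβ (t := 1)
    (by have : 0 < 1 / (4 * ((finrank ℝ V : ℝ) + 8)) := by positivity
        linarith)
  have hmom3 := integral_pow_mul_exp_neg_le hA hlam hcoer 3 hβ (t := 1 - τ) (by rw [← hM]; linarith)
  rw [← hM, ← h𝔊] at hmom1 hmom2 hmom3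
  -- chain
  have h1 : |∫ y in B, ((Real.exp (-(β * (((1 / 2) * ⟪A y, y⟫_ℝ) + c y + r y))) * (1 + ℓ y + e y)) - Real.exp (-(β * ((1 / 2) * ⟪A y, y⟫_ℝ))) - (Real.exp (-(β * ((1 / 2) * ⟪A y, y⟫_ℝ))) * (-(β * c y) + ℓ y)))| ≤ ∫ y in B, |(Real.exp (-(β * (((1 / 2) * ⟪A y, y⟫_ℝ) + c y + r y))) * (1 + ℓ y + e y)) - Real.exp (-(β * ((1 / 2) * ⟪A y, y⟫_ℝ))) - (Real.exp (-(β * ((1 / 2) * ⟪A y, y⟫_ℝ))) * (-(β * c y) + ℓ y))| :=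
    abs_integral_le_integral_abs
  have h2 : ∫ y in B, |(Real.exp (-(β * (((1 / 2) * ⟪A y, y⟫_ℝ) + c y + r y))) * (1 + ℓ y + e y)) - Real.exp (-(β * ((1 / 2) * ⟪A y, y⟫_ℝ))) - (Real.exp (-(β * ((1 / 2) * ⟪A y, y⟫_ℝ))) * (-(β * c y) + ℓ y))| ≤ ∫ y in B, (G * (2 / lam) * (((1 / 2) * ⟪A y, y⟫_ℝ) ^ 1 * Real.exp (-(1 * β * ((1 / 2) * ⟪A y, y⟫_ℝ)))) + β * (A₄ + (A₃ + A₄ * R) * (D + G * R)) * (2 / lam) ^ 2 * (((1 / 2) * ⟪A y, y⟫_ℝ) ^ 2 * Real.exp (-(1 * β * ((1 / 2) * ⟪A y, y⟫_ℝ)))) + 3 * β ^ 2 * (A₃ + A₄ * R) ^ 2 * (2 / lam) ^ 3 * (((1 / 2) * ⟪A y, y⟫_ℝ) ^ 3 * Real.exp (-((1 - 2 * (A₃ * R + A₄ * R ^ 2) / lam) * β * ((1 / 2) * ⟪A y, y⟫_ℝ))))) :=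
    setIntegral_mono_on ((hgB.sub hg₀B).sub hodB).abs hbint.integrableOn hBm fun y hy =>
      laplace_pointwise_remainder_le hlam hcoer hA₃ hA₄ hD hG hβ hDR hGR hc hr hℓ he y (by simpa [hB] using hy)
  have h3 : ∫ y in B, (G * (2 / lam) * (((1 / 2) * ⟪A y, y⟫_ℝ) ^ 1 * Real.exp (-(1 * β * ((1 / 2) * ⟪A y, y⟫_ℝ)))) + β * (A₄ + (A₃ + A₄ * R) * (D + G * R)) * (2 / lam) ^ 2 * (((1 / 2) * ⟪A y, y⟫_ℝ) ^ 2 * Real.exp (-(1 * β * ((1 / 2) * ⟪A y, y⟫_ℝ)))) + 3 * β ^ 2 * (A₃ + A₄ * R) ^ 2 * (2 / lam) ^ 3 * (((1 / 2) * ⟪A y, y⟫_ℝ) ^ 3 * Real.exp (-((1 - 2 * (A₃ * R + A₄ * R ^ 2) / lam) * β * ((1 / 2) * ⟪A y, y⟫_ℝ))))) ≤ ∫ y, (G * (2 / lam) * (((1 / 2) * ⟪A y, y⟫_ℝ) ^ 1 * Real.exp (-(1 * β * ((1 / 2) * ⟪A y, y⟫_ℝ)))) + β * (A₄ + (A₃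 + A₄ * R) * (D + G * R)) * (2 / lam) ^ 2 * (((1 / 2) * ⟪A y, y⟫_ℝ) ^ 2 * Real.exp (-(1 * β * ((1 / 2) * ⟪A y, y⟫_ℝ)))) + 3 * β ^ 2 * (A₃ + A₄ * R) ^ 2 * (2 / lam) ^ 3 * (((1 / 2) * ⟪A y, y⟫_ℝ) ^ 3 * Real.exp (-((1 - 2 * (A₃ * R + A₄ * R ^ 2) / lam) * β * ((1 / 2) * ⟪A y, y⟫_ℝ))))) :=
    setIntegral_le_integral hbint (Eventually.of_forall hb0)
  have hb12int : Integrable fun y : V => G * (2 / lam) * (((1 / 2) * ⟪A y, y⟫_ℝ) ^ 1 * Real.exp (-(1 * β * ((1 / 2) * ⟪A y, y⟫_ℝ)))) + β * (A₄ + (A₃ + A₄ * R) * (D + G * R)) * (2 / lam) ^ 2 * (((1 / 2) * ⟪A y, y⟫_ℝ) ^ 2 * Real.exp (-(1 * β * ((1 / 2) * ⟪A y, y⟫_ℝ)))) := hb₁int.add hb₂int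
  have h4 : ∫ y, (G * (2 / lam) * (((1 / 2) * ⟪A y, y⟫_ℝ) ^ 1 * Real.exp (-(1 * β * ((1 / 2) * ⟪A y, y⟫_ℝ)))) + β * (A₄ + (A₃ + A₄ * R) * (D + G * R)) * (2 / lam) ^ 2 * (((1 / 2) * ⟪A y, y⟫_ℝ) ^ 2 * Real.exp (-(1 * β * ((1 / 2) * ⟪A y, y⟫_ℝ)))) + 3 * β ^ 2 * (A₃ + A₄ * R) ^ 2 * (2 / lam) ^ 3 * (((1 / 2) * ⟪A y, y⟫_ℝ) ^ 3 * Real.exp (-((1 - 2 * (A₃ * R + A₄ * R ^ 2) / lam) * β * ((1 / 2) * ⟪A y, y⟫_ℝ))))) = (∫ y, G * (2 / lam) * (((1 / 2) * ⟪A y, y⟫_ℝ) ^ 1 * Real.exp (-(1 * β * ((1 / 2) * ⟪A y, y⟫_ℝ))))) + (∫ y, β * (A₄ + (A₃ + A₄ * R) * (D + G * R)) * (2 / lam) ^ 2 * (((1 / 2) * ⟪A y, y⟫_ℝ) ^ 2 * Real.exp (-(1 * β * ((1 / 2) * ⟪A y, y⟫_ℝ))))) + ∫ y, 3 * β ^ 2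 * (A₃ + A₄ * R) ^ 2 * (2 / lam) ^ 3 * (((1 / 2) * ⟪A y, y⟫_ℝ) ^ 3 * Real.exp (-((1 - 2 * (A₃ * R + A₄ * R ^ 2) / lam) * β * ((1 / 2) * ⟪A y, y⟫_ℝ)))) := by
    rw [integral_add hb12int hb₃int, integral_add hb₁int hb₂int]
  have i1 : ∫ y, G * (2 / lam) * (((1 / 2) * ⟪A y, y⟫_ℝ) ^ 1 * Real.exp (-(1 * β * ((1 / 2) * ⟪A y, y⟫_ℝ)))) ≤ 16 * G * M / lam / β * 𝔊 := by
    rw [integral_const_mul]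
    calc G * (2 / lam) * ∫ y : V, ((1 / 2) * ⟪A y, y⟫_ℝ) ^ 1 * Real.exp (-(1 * β * ((1 / 2) * ⟪A y, y⟫_ℝ)))
        ≤ G * (2 / lam) * (2 * (Nat.factorial 1) * (4 * M / β) ^ 1 * 𝔊) := by gcongr
      _ = 16 * G * M / lam / β * 𝔊 := by simp [Nat.factorial]; ring
  have i2 : ∫ y, β * (A₄ + (A₃ + A₄ * R) * (D + G * R)) * (2 / lam) ^ 2 * (((1 / 2) * ⟪A y, y⟫_ℝ) ^ 2 * Real.exp (-(1 * β * ((1 / 2) * ⟪A y, y⟫_ℝ)))) ≤ 256 * (A₄ + (A₃ + A₄ * R) * (D + G * R)) * M ^ 2 / lam ^ 2 / β * 𝔊 := by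
    rw [integral_const_mul]
    calc β * (A₄ + (A₃ + A₄ * R) * (D + G * R)) * (2 / lam) ^ 2 *
          ∫ y : V, ((1 / 2) * ⟪A y, y⟫_ℝ) ^ 2 * Real.exp (-(1 * β * ((1 / 2) * ⟪A y, y⟫_ℝ)))
        ≤ β * (A₄ + (A₃ + A₄ * R) * (D + G * R)) * (2 / lam) ^ 2 *
          (2 * (Nat.factorial 2) * (4 * M / β) ^ 2 * 𝔊) := by gcongr
      _ = 256 * (A₄ + (A₃ + A₄ * R) * (D + G * R)) * M ^ 2 / lam ^ 2 / β * 𝔊 := by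
          simp [Nat.factorial]; field_simp; ring
  have i3 : ∫ y, 3 * β ^ 2 * (A₃ + A₄ * R) ^ 2 * (2 / lam) ^ 3 * (((1 / 2) * ⟪A y, y⟫_ℝ) ^ 3 * Real.exp (-((1 - 2 * (A₃ * R + A₄ * R ^ 2) / lam) * β * ((1 / 2) * ⟪A y, y⟫_ℝ)))) ≤ 18432 * (A₃ + A₄ * R) ^ 2 * M ^ 3 / lam ^ 3 / β * 𝔊 := by
    rw [integral_const_mul]
    calc 3 * β ^ 2 * (A₃ + A₄ * R) ^ 2 * (2 / lam) ^ 3 *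
          ∫ y : V, ((1 / 2) * ⟪A y, y⟫_ℝ) ^ 3 * Real.exp (-((1 - 2 * (A₃ * R + A₄ * R ^ 2) / lam) * β * ((1 / 2) * ⟪A y, y⟫_ℝ)))
        ≤ 3 * β ^ 2 * (A₃ + A₄ * R) ^ 2 * (2 / lam) ^ 3 * (2 * (Nat.factorial 3) * (4 * M / β) ^ 3 * 𝔊) := by
          gcongr
      _ = 18432 * (A₃ + A₄ * R) ^ 2 * M ^ 3 / lam ^ 3 / β * 𝔊 := by
          simp [Nat.factorial]; field_simp; ring
  calc |∫ y in B, ((Real.exp (-(β * (((1 / 2) * ⟪A y, y⟫_ℝ) + c y + r y))) * (1 + ℓ y + e y)) - Real.exp (-(β * ((1 / 2) * ⟪A y, y⟫_ℝ))) - (Real.exp (-(β * ((1 / 2) * ⟪A y, y⟫_ℝ))) * (-(β * c y) + ℓ y)))|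
      ≤ (∫ y, G * (2 / lam) * (((1 / 2) * ⟪A y, y⟫_ℝ) ^ 1 * Real.exp (-(1 * β * ((1 / 2) * ⟪A y, y⟫_ℝ))))) + (∫ y, β * (A₄ + (A₃ + A₄ * R) * (D + G * R)) * (2 / lam) ^ 2 * (((1 / 2) * ⟪A y, y⟫_ℝ) ^ 2 * Real.exp (-(1 * β * ((1 / 2) * ⟪A y, y⟫_ℝ))))) + ∫ y, 3 * β ^ 2 * (A₃ + A₄ * R) ^ 2 * (2 / lam) ^ 3 * (((1 / 2) * ⟪A y, y⟫_ℝ) ^ 3 * Real.exp (-((1 - 2 * (A₃ * R + A₄ * R ^ 2) / lam) * β * ((1 / 2) * ⟪A y, y⟫_ℝ)))) := by linarith [h1, h2, h3, h4]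
    _ ≤ 16 * G * M / lam / β * 𝔊 + 256 * (A₄ + (A₃ + A₄ * R) * (D + G * R)) * M ^ 2 / lam ^ 2 / β * 𝔊
        + 18432 * (A₃ + A₄ * R) ^ 2 * M ^ 3 / lam ^ 3 / β * 𝔊 := by linarith [i1, i2, i3]
    _ = _ := by ring

/-- **Laplace's method with an explicit, dimension-polynomial `O(1/β)` remainder** (interior non-degenerate
minimum; the odd first-order terms integrate to zero on the symmetric ball).  See the module docstring for
the statement in words; `m = finrank ℝ V`, `𝔊(β) = (2π/β)^{m/2}/√det A`.
[cite: Breitung1994, Thm 41 p. 56] [cite: Wong2001AsymptoticApproximationsIntegrals, §IX.5] -/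
theorem laplaceMethod_quantitative (hA : A.IsSymmetric) (hlam : 0 < lam)
    (hcoer : ∀ y : V, lam * ‖y‖ ^ 2 ≤ ⟪A y, y⟫_ℝ)
    {R A₃ A₄ D G β : ℝ} (hR : 0 < R) (hA₃ : 0 ≤ A₃) (hA₄ : 0 ≤ A₄) (hD : 0 ≤ D) (hG : 0 ≤ G)
    (hβ : 0 < β)
    (hsmall : A₃ * R + A₄ * R ^ 2 ≤ lam / (8 * ((finrank ℝ V : ℝ) + 8)))
    (hDR : D * R ≤ 1) (hGR : G * R ^ 2 ≤ 1)
    {c r ℓ e : V → ℝ} (hc_meas : Measurable c) (hr_meas : Measurable r) (hℓ_meas : Measurable ℓ)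
    (he_meas : Measurable e) (hc_odd : ∀ y, c (-y) = -c y) (hℓ_odd : ∀ y, ℓ (-y) = -ℓ y)
    (hc : ∀ y : V, ‖y‖ ≤ R → |c y| ≤ A₃ * ‖y‖ ^ 3) (hr : ∀ y : V, ‖y‖ ≤ R → |r y| ≤ A₄ * ‖y‖ ^ 4)
    (hℓ : ∀ y : V, ‖y‖ ≤ R → |ℓ y| ≤ D * ‖y‖) (he : ∀ y : V, ‖y‖ ≤ R → |e y| ≤ G * ‖y‖ ^ 2) :
    |(∫ y in closedBall (0 : V) R, (Real.exp (-(β * (((1 / 2) * ⟪A y, y⟫_ℝ) + c y + r y))) * (1 + ℓ y + e y))) - ((2 * π / β) ^ ((finrank ℝ V : ℝ) / 2) / Real.sqrt (LinearMap.det A))| ≤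
      (16 * ((finrank ℝ V : ℝ) + 8) / (lam * R ^ 2) + 16 * G * ((finrank ℝ V : ℝ) + 8) / lam
        + 256 * (A₄ + (A₃ + A₄ * R) * (D + G * R)) * ((finrank ℝ V : ℝ) + 8) ^ 2 / lam ^ 2
        + 18432 * (A₃ + A₄ * R) ^ 2 * ((finrank ℝ V : ℝ) + 8) ^ 3 / lam ^ 3) / β * ((2 * π / β) ^ ((finrank ℝ V : ℝ) / 2) / Real.sqrt (LinearMap.det A)) := by
  set M : ℝ := ((finrank ℝ V : ℝ) + 8) with hM
  set 𝔊 : ℝ := ((2 * π / β) ^ ((finrank ℝ V : ℝ) / 2) / Real.sqrt (LinearMap.det A)) with h𝔊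
  set B : Set V := closedBall (0 : V) R with hB
  have hm0 : (0 : ℝ) ≤ (finrank ℝ V : ℝ) := Nat.cast_nonneg _
  -- measurability and integrability on the ball (as in the remainder lemma)
  have hq_meas : Measurable fun y : V => ((1 / 2) * ⟪A y, y⟫_ℝ) := (continuous_half_inner A).measurable
  have hg_meas : Measurable fun y : V => (Real.exp (-(β * (((1 / 2) * ⟪A y, y⟫_ℝ) + c y + r y))) * (1 + ℓ y + e y)) :=
    ((((hq_meas.add hc_meas).add hr_meas).const_mul β).neg.exp).mul
      ((measurable_const.add hℓ_meas).add he_meas)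
  have hg₀_meas : Measurable fun y : V => Real.exp (-(β * ((1 / 2) * ⟪A y, y⟫_ℝ))) := (hq_meas.const_mul β).neg.exp
  have hod_meas : Measurable fun y : V => (Real.exp (-(β * ((1 / 2) * ⟪A y, y⟫_ℝ))) * (-(β * c y) + ℓ y)) := hg₀_meas.mul ((hc_meas.const_mul β).neg.add hℓ_meas)
  have hBfin : volume B ≠ ⊤ := by rw [hB]; exact measure_closedBall_lt_top.ne
  have hBm : MeasurableSet B := by rw [hB]; exact measurableSet_closedBall
  have hgB : IntegrableOn (fun y : V => (Real.exp (-(β * (((1 / 2) * ⟪A y, y⟫_ℝ) + c y + r y))) * (1 + ℓ y + e y))) B :=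
    Measure.integrableOn_of_bounded hBfin hg_meas.aestronglyMeasurable
      ((ae_restrict_iff' hBm).mpr (Eventually.of_forall fun y hy => by
        rw [Real.norm_eq_abs]
        exact laplace_abs_integrand_le_three hlam hcoer hA₃ hA₄ hD hG hβ hsmall hDR hGR hc hr hℓ he y
          (by simpa [hB] using hy)))
  have hodB : IntegrableOn (fun y : V => (Real.exp (-(β * ((1 / 2) * ⟪A y, y⟫_ℝ))) * (-(β * c y) + ℓ y))) B :=
    Measure.integrableOn_of_bounded hBfin hod_meas.aestronglyMeasurable
      ((ae_restrict_iff' hBm).mpr (Eventually.of_forall fun y hy => by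
        rw [Real.norm_eq_abs]
        exact laplace_abs_odd_le hlam hcoer hA₃ hD hβ hc hℓ y (by simpa [hB] using hy)))
  have hg₀int : Integrable (fun y : V => Real.exp (-(β * ((1 / 2) * ⟪A y, y⟫_ℝ)))) := integrable_exp_neg_mul_half_inner hlam hcoer hβ
  have hg₀B : IntegrableOn (fun y : V => Real.exp (-(β * ((1 / 2) * ⟪A y, y⟫_ℝ)))) B := hg₀int.integrableOn
  -- (1) split the ball integral
  have hI1 : IntegrableOn (fun y : V => Real.exp (-(β * ((1 / 2) * ⟪A y, y⟫_ℝ))) + (Real.exp (-(β * ((1 / 2) * ⟪A y, y⟫_ℝ))) * (-(β * c y) + ℓ y))) B := hg₀B.add hodB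
  have hI2 : IntegrableOn (fun y : V => (Real.exp (-(β * (((1 / 2) * ⟪A y, y⟫_ℝ) + c y + r y))) * (1 + ℓ y + e y)) - Real.exp (-(β * ((1 / 2) * ⟪A y, y⟫_ℝ))) - (Real.exp (-(β * ((1 / 2) * ⟪A y, y⟫_ℝ))) * (-(β * c y) + ℓ y))) B := (hgB.sub hg₀B).sub hodB
  have hsplit : ∫ y in B, (Real.exp (-(β * (((1 / 2) * ⟪A y, y⟫_ℝ) + c y + r y))) * (1 + ℓ y + e y)) = (∫ y in B, Real.exp (-(β * ((1 / 2) * ⟪A y, y⟫_ℝ)))) + (∫ y in B, (Real.exp (-(β * ((1 / 2) * ⟪A y, y⟫_ℝ))) * (-(β * c y) + ℓ y)))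
      + ∫ y in B, ((Real.exp (-(β * (((1 / 2) * ⟪A y, y⟫_ℝ) + c y + r y))) * (1 + ℓ y + e y)) - Real.exp (-(β * ((1 / 2) * ⟪A y, y⟫_ℝ))) - (Real.exp (-(β * ((1 / 2) * ⟪A y, y⟫_ℝ))) * (-(β * c y) + ℓ y))) := by
    rw [← integral_add hg₀B hodB, ← integral_add hI1 hI2]
    congr 1; funext y; ring
  -- (2) the odd part vanishes
  have hodd0 : ∫ y in B, (Real.exp (-(β * ((1 / 2) * ⟪A y, y⟫_ℝ))) * (-(β * c y) + ℓ y)) = 0 := by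
    rw [hB]
    apply setIntegral_closedBall_eq_zero_of_odd
    intro y
    rw [map_neg, inner_neg_neg, hc_odd, hℓ_odd]
    ring
  -- (3) the Gaussian part = whole space − tail
  have h𝔊int : ∫ y : V, Real.exp (-(β * ((1 / 2) * ⟪A y, y⟫_ℝ))) = 𝔊 := by
    rw [h𝔊]; exact integral_exp_neg_mul_half_inner hA hlam hcoer hβ
  have htail_split : (∫ y in B, Real.exp (-(β * ((1 / 2) * ⟪A y, y⟫_ℝ)))) + ∫ y in Bᶜ, Real.exp (-(β * ((1 / 2) * ⟪A y, y⟫_ℝ))) = 𝔊 := by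
    rw [integral_add_compl hBm hg₀int, h𝔊int]
  have htail0 : 0 ≤ ∫ y in Bᶜ, Real.exp (-(β * ((1 / 2) * ⟪A y, y⟫_ℝ))) := integral_nonneg fun y => (Real.exp_pos _).le
  have htail : ∫ y in Bᶜ, Real.exp (-(β * ((1 / 2) * ⟪A y, y⟫_ℝ))) ≤ 16 * M / (lam * R ^ 2) / β * 𝔊 := by
    rw [hB, hM, h𝔊]; exact laplace_tail_le hA hlam hcoer hR hβ
  -- (4) the remainder
  have hrem : |∫ y in B, ((Real.exp (-(β * (((1 / 2) * ⟪A y, y⟫_ℝ) + c y + r y))) * (1 + ℓ y + e y)) - Real.exp (-(β * ((1 / 2) * ⟪A y, y⟫_ℝ))) - (Real.exp (-(β * ((1 / 2) * ⟪A y, y⟫_ℝ))) * (-(β * c y) + ℓ y)))| ≤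
      (16 * G * M / lam + 256 * (A₄ + (A₃ + A₄ * R) * (D + G * R)) * M ^ 2 / lam ^ 2
        + 18432 * (A₃ + A₄ * R) ^ 2 * M ^ 3 / lam ^ 3) / β * 𝔊 := by
    rw [hB, hM, h𝔊]
    exact laplace_remainder_integral_le hA hlam hcoer hR hA₃ hA₄ hD hG hβ hsmall hDR hGR hc_meas hr_meas
      hℓ_meas he_meas hc hr hℓ he
  -- (5) assemble
  have hfinal : (∫ y in B, (Real.exp (-(β * (((1 / 2) * ⟪A y, y⟫_ℝ) + c y + r y))) * (1 + ℓ y + e y))) - 𝔊 = (∫ y in B, ((Real.exp (-(β * (((1 / 2) * ⟪A y, y⟫_ℝ) + c y + r y))) * (1 + ℓ y + e y)) - Real.exp (-(β * ((1 / 2) * ⟪A y, y⟫_ℝ))) - (Real.exp (-(β * ((1 / 2) * ⟪A y, y⟫_ℝ))) * (-(β * c y) + ℓ y)))) - ∫ y in Bᶜ, Real.exp (-(β * ((1 / 2) * ⟪A y, y⟫_ℝ))) := by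
    rw [hsplit, hodd0]; linarith
  rw [hfinal]
  calc |(∫ y in B, ((Real.exp (-(β * (((1 / 2) * ⟪A y, y⟫_ℝ) + c y + r y))) * (1 + ℓ y + e y)) - Real.exp (-(β * ((1 / 2) * ⟪A y, y⟫_ℝ))) - (Real.exp (-(β * ((1 / 2) * ⟪A y, y⟫_ℝ))) * (-(β * c y) + ℓ y)))) - ∫ y in Bᶜ, Real.exp (-(β * ((1 / 2) * ⟪A y, y⟫_ℝ)))|
      ≤ |∫ y in B, ((Real.exp (-(β * (((1 / 2) * ⟪A y, y⟫_ℝ) + c y + r y))) * (1 + ℓ y + e y)) - Real.exp (-(β * ((1 / 2) * ⟪A y, y⟫_ℝ))) - (Real.exp (-(β * ((1 / 2) * ⟪A y, y⟫_ℝ))) * (-(β * c y) + ℓ y)))| + |∫ y in Bᶜ, Real.exp (-(β * ((1 / 2) * ⟪A y, y⟫_ℝ)))| := abs_sub _ _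
    _ ≤ (16 * G * M / lam + 256 * (A₄ + (A₃ + A₄ * R) * (D + G * R)) * M ^ 2 / lam ^ 2
        + 18432 * (A₃ + A₄ * R) ^ 2 * M ^ 3 / lam ^ 3) / β * 𝔊 + 16 * M / (lam * R ^ 2) / β * 𝔊 := by
        rw [abs_of_nonneg htail0]; exact add_le_add hrem htail
    _ = _ := by ring

/-- **Consumer form** of `laplaceMethod_quantitative`: a phase `f` and a weight `w` that AGREE on the closed ball
with `½⟪Ay,y⟫ + c + r` and `w₀(1 + ℓ + e)` (`w₀ ≥ 0`), conclusion
`|∫_{‖y‖≤R} e^{−βf} w − w₀𝔊(β)| ≤ (K/β)·w₀𝔊(β)`. [cite: Breitung1994, Thm 41 p. 56] -/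
theorem laplaceMethod_quantitative_of_eqOn (hA : A.IsSymmetric) (hlam : 0 < lam)
    (hcoer : ∀ y : V, lam * ‖y‖ ^ 2 ≤ ⟪A y, y⟫_ℝ)
    {R A₃ A₄ D G β w₀ : ℝ} (hR : 0 < R) (hA₃ : 0 ≤ A₃) (hA₄ : 0 ≤ A₄) (hD : 0 ≤ D) (hG : 0 ≤ G)
    (hβ : 0 < β) (hw₀ : 0 ≤ w₀)
    (hsmall : A₃ * R + A₄ * R ^ 2 ≤ lam / (8 * ((finrank ℝ V : ℝ) + 8)))
    (hDR : D * R ≤ 1) (hGR : G * R ^ 2 ≤ 1)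
    {f w c r ℓ e : V → ℝ} (hc_meas : Measurable c) (hr_meas : Measurable r) (hℓ_meas : Measurable ℓ)
    (he_meas : Measurable e) (hc_odd : ∀ y, c (-y) = -c y) (hℓ_odd : ∀ y, ℓ (-y) = -ℓ y)
    (hc : ∀ y : V, ‖y‖ ≤ R → |c y| ≤ A₃ * ‖y‖ ^ 3) (hr : ∀ y : V, ‖y‖ ≤ R → |r y| ≤ A₄ * ‖y‖ ^ 4)
    (hℓ : ∀ y : V, ‖y‖ ≤ R → |ℓ y| ≤ D * ‖y‖) (he : ∀ y : V, ‖y‖ ≤ R → |e y| ≤ G * ‖y‖ ^ 2)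
    (hf : ∀ y : V, ‖y‖ ≤ R → f y = (1 / 2) * ⟪A y, y⟫_ℝ + c y + r y)
    (hw : ∀ y : V, ‖y‖ ≤ R → w y = w₀ * (1 + ℓ y + e y)) :
    |(∫ y in closedBall (0 : V) R, Real.exp (-(β * f y)) * w y) - w₀ * ((2 * π / β) ^ ((finrank ℝ V : ℝ) / 2) / Real.sqrt (LinearMap.det A))| ≤
      (16 * ((finrank ℝ V : ℝ) + 8) / (lam * R ^ 2) + 16 * G * ((finrank ℝ V : ℝ) + 8) / lam
        + 256 * (A₄ + (A₃ + A₄ * R) * (D + G * R)) * ((finrank ℝ V : ℝ) + 8) ^ 2 / lam ^ 2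
        + 18432 * (A₃ + A₄ * R) ^ 2 * ((finrank ℝ V : ℝ) + 8) ^ 3 / lam ^ 3) / β * (w₀ * ((2 * π / β) ^ ((finrank ℝ V : ℝ) / 2) / Real.sqrt (LinearMap.det A))) := by
  have h := laplaceMethod_quantitative hA hlam hcoer hR hA₃ hA₄ hD hG hβ hsmall hDR hGR hc_meas hr_meas hℓ_meas
    he_meas hc_odd hℓ_odd hc hr hℓ he
  have hcongr : ∫ y in closedBall (0 : V) R, Real.exp (-(β * f y)) * w y =
      w₀ * ∫ y in closedBall (0 : V) R,
        Real.exp (-(β * (((1 / 2) * ⟪A y, y⟫_ℝ) + c y + r y))) * (1 + ℓ y + e y) := by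
    rw [← integral_const_mul]
    refine setIntegral_congr_fun measurableSet_closedBall fun y hy => ?_
    have hyR : ‖y‖ ≤ R := by simpa using hy
    rw [hf y hyR, hw y hyR]; ring
  rw [hcongr, ← mul_sub, abs_mul, abs_of_nonneg hw₀]
  calc w₀ * |(∫ y in closedBall (0 : V) R,
          Real.exp (-(β * (((1 / 2) * ⟪A y, y⟫_ℝ) + c y + r y))) * (1 + ℓ y + e y)) - ((2 * π / β) ^ ((finrank ℝ V : ℝ) / 2) / Real.sqrt (LinearMap.det A))|
      ≤ w₀ * ((16 * ((finrank ℝ V : ℝ) + 8) / (lam * R ^ 2) + 16 * G * ((finrank ℝ V : ℝ) + 8) / lam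
        + 256 * (A₄ + (A₃ + A₄ * R) * (D + G * R)) * ((finrank ℝ V : ℝ) + 8) ^ 2 / lam ^ 2
        + 18432 * (A₃ + A₄ * R) ^ 2 * ((finrank ℝ V : ℝ) + 8) ^ 3 / lam ^ 3) / β * ((2 * π / β) ^ ((finrank ℝ V : ℝ) / 2) / Real.sqrt (LinearMap.det A))) :=
        mul_le_mul_of_nonneg_left h hw₀
    _ = _ := by ring

end MainB

end Summit.QuantumFields.YangMills.Theorems.QuantitativeLaplace
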